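import Mathlib
import Summits.Schanuel.Schanuel.Theses.CoprimeExpPolynomials

/-!
# Birth skeleton (BC3) for crux `CoprimeExpPolynomialsFiniteCommonZeros` (stmt-Schanuel-3764)
# of route `CoprimeExpPolynomials` — Shapiro's conjecture over ℚ̄, Ritt-sector form

The crux (Shapiro 1958 over ℚ̄, polynomial coefficients allowed):
for `β : Fin n → ℚ̄` ℚ-linearly independent and `P Q ∈ ℚ̄[X₀, X₁, …, Xₙ]` relatively prime, the set of
common zeros `z ∈ ℂ` of `P(z, e^{β₁z}, …, e^{βₙz})` and `Q(z, e^{β₁z}, …, e^{βₙz})` is finite.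

This skeleton types the route's own foreseen two-layer plan for the crux
("crux 3 ⇐ ShapiroQbarSimpleFactor → ShapiroQbarTwoIrreducibles → crux 3, glue = Ritt–MacColl
factorisation reduces a coprime pair to the two cases", route header TWO-LAYER PLAN) WITHOUT a
Ritt-factorisation fact: the reduction to IRREDUCIBLE factor pairs is done here, sorry-free, in the
UFD `ℚ̄[X₀, …, Xₙ]` (Mathlib: `MvPolynomial.uniqueFactorizationMonoid`, peeled off one irreducible at
a time by `WfDvdMonoid.induction_on_irreducible`), and Ritt's dichotomy simple / not simple is the
decidable-in-principle support condition

  `Collinear P` :≡ `∃ a v : Fin n → ℤ, ∀ m ∈ P.support, ∃ k : ℤ, ∀ i, (m (i+1) : ℤ) = a i + k * v i`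

(the exponent vectors of the exponential variables `X₁..Xₙ` lie on one affine line, i.e. the
frequencies `Σ mᵢβᵢ` of `P` span a rank-≤-1 group after a unit shift: Ritt's "simple", D'Aquino–
Macintyre–Terzo 2014 Def. 2.3, extended verbatim to polynomial coefficients).

## Stubs (the three sectors; each is the crux restricted to a sector, so crux ⇒ stub trivially,
## and the sectors are jointly exhaustive only through the factorisation glue below)

* `stub_simpleFactorConstCoeff` — P an irreducible SIMPLE factor with CONSTANT coefficients
  (`X₀` absent from `P`), `Q` arbitrary (polynomial coefficients allowed), coprime ⇒ finitely many
  common zeros. KNOWN MECHANISM in print: Shapiro's own remark (Laczkovich, Enseign. Math. 50 (2004)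
  p. 4: "the Lech–Mahler theorem implies the conjecture when one of the exponential polynomials is
  simple"), van der Poorten–Tijdeman 1975 (Enseign. Math. 21, 57–67), D'Aquino–Macintyre–Terzo 2014
  Thm 3.3 ("Case 1", stated in the constant-coefficient ring 𝓔): the zeros of `P` lie on finitely
  many arithmetic progressions, `k ↦ Q` along a progression is a linear recurrence sequence (also
  when `Q` has polynomial coefficients), Skolem–Mahler–Lech gives a full sub-progression of zeros,
  and vanishing on a full progression forces the factor of `P` to divide `Q`. Far from Mathlib
  (p-adic SML) but a theorem-grade target — the "engine that already bites" of the route header; the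
  transfer "common factor in the exponential ring ⇒ ¬ IsRelPrime in ℚ̄[X₀..Xₙ]" is the route's
  encoding lemma (header, KILL CRITERIA).
* `stub_simpleFactorPolyCoeff` — P an irreducible simple factor in which `X₀` DOES occur
  (e.g. `X₀X₁ − 1`, i.e. `z e^{z} = 1`), `Q` arbitrary, coprime ⇒ finite. The zeros of `P` are
  Lambert-W-type perturbed progressions on which SML no longer applies verbatim: the first open cell
  above the known sector (the route's "ShapiroQbarSimpleFactor with polynomial coefficients").
* `stub_irreducibleNonSimplePair` — P, Q both irreducible, both NOT simple, coprime ⇒ finite: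
  Ritt's Case 2 (D'Aquino–Macintyre–Terzo 2014 §5 prove the constant-coefficient case over ℂ under
  Schanuel via Bombieri–Masser–Zannier + Evertse–Schlickewei–Schmidt; over ℚ̄ it follows from
  Schanuel through crux 2 `CoprimeExpPolynomialsNoCommonZero`, FischlerRivoal2025 Thm 1.7). OPEN
  unconditionally — the hard cell.

## Assembly (sorry-free)

`finite_common_zeros_of_sectors : SimpleFactorConstCoeff → SimpleFactorPolyCoeff →
IrreducibleNonSimplePair → ∀ n β, LinearIndependent ℚ β → ∀ P Q, IsRelPrime P Q → (Z β P Q).Finite`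
(the three `def`s are the stub statements verbatim) and
`CoprimeExpPolynomialsFiniteCommonZeros_of : CoprimeExpPolynomialsFiniteCommonZeros` applies it to
the three stubs (the skeleton audit wants the concluding theorem hypothesis-free, stubs by name).
Proof: `Z(P₁P₂, Q) = Z(P₁, Q) ∪ Z(P₂, Q)` (ℂ is a domain), `Z(unit, Q) = ∅`, `IsRelPrime 0 Q ⇒ Q`
unit, coprimality descends to factors (`IsRelPrime.of_mul_*`); induct on `P`, and for a non-simple
irreducible factor `p` induct on `Q`; dispatch each irreducible pair `(p, q)` to sector A0/A1 if `p`
or `q` is collinear (using the symmetry `Z(p, q) = Z(q, p)`), else to sector B.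

Disproof used: none relevant (no `Disproof.lean` / Negative lemma exists for this crux at birth;
`ledger negatives --problem Schanuel` lists no statement about zero sets of exponential polynomials).
-/

namespace Summit.Schanuel.Schanuel.Cruxes.CoprimeExpPolynomialsFiniteCommonZeros.Birth

open Summit.Schanuel.Schanuel.Theses.CoprimeExpPolynomials

/-! ## The three stubs -/

/-- STUB A0 (KNOWN MECHANISM: Skolem–Mahler–Lech on the progressions of zeros of `P`;
van der Poorten–Tijdeman 1975, D'Aquino–Macintyre–Terzo 2014 Thm 3.3 for constant coefficients) —
Shapiro over ℚ̄ for an irreducible SIMPLE factor with CONSTANT coefficients against an arbitrary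
coprime exponential polynomial (polynomial coefficients allowed in `Q`). -/
theorem stub_simpleFactorConstCoeff :
    ∀ (n : ℕ) (β : Fin n → ↥(algebraicClosure ℚ ℂ))
      (P Q : MvPolynomial (Fin (n + 1)) ↥(algebraicClosure ℚ ℂ)),
      LinearIndependent ℚ β → Irreducible P →
      (∃ a v : Fin n → ℤ, ∀ m ∈ P.support, ∃ k : ℤ, ∀ i : Fin n,
          ((m (Fin.succ i) : ℕ) : ℤ) = a i + k * v i) →
      (∀ m ∈ P.support, m 0 = 0) →
      IsRelPrime P Q →
      Set.Finite {z : ℂ | MvPolynomial.aeval (Fin.cons z fun i => Complex.exp ((β i : ℂ) * z)) P = 0 ∧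
        MvPolynomial.aeval (Fin.cons z fun i => Complex.exp ((β i : ℂ) * z)) Q = 0} := by
  sorry

/-- STUB A1 (OPEN cell, "simple factor with polynomial coefficients") — Shapiro over ℚ̄ for an
irreducible SIMPLE factor in which the polynomial variable `X₀` occurs, against an arbitrary coprime
exponential polynomial. -/
theorem stub_simpleFactorPolyCoeff :
    ∀ (n : ℕ) (β : Fin n → ↥(algebraicClosure ℚ ℂ))
      (P Q : MvPolynomial (Fin (n + 1)) ↥(algebraicClosure ℚ ℂ)),
      LinearIndependent ℚ β → Irreducible P →
      (∃ a v : Fin n → ℤ, ∀ m ∈ P.support, ∃ k : ℤ, ∀ i : Fin n,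
          ((m (Fin.succ i) : ℕ) : ℤ) = a i + k * v i) →
      (∃ m ∈ P.support, m 0 ≠ 0) →
      IsRelPrime P Q →
      Set.Finite {z : ℂ | MvPolynomial.aeval (Fin.cons z fun i => Complex.exp ((β i : ℂ) * z)) P = 0 ∧
        MvPolynomial.aeval (Fin.cons z fun i => Complex.exp ((β i : ℂ) * z)) Q = 0} := by
  sorry

/-- STUB B (OPEN, Ritt's Case 2: D'Aquino–Macintyre–Terzo 2014 §5 under Schanuel) — Shapiro over ℚ̄
for two irreducible NON-simple coprime exponential polynomials. -/
theorem stub_irreducibleNonSimplePair :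
    ∀ (n : ℕ) (β : Fin n → ↥(algebraicClosure ℚ ℂ))
      (P Q : MvPolynomial (Fin (n + 1)) ↥(algebraicClosure ℚ ℂ)),
      LinearIndependent ℚ β → Irreducible P → Irreducible Q →
      ¬ (∃ a v : Fin n → ℤ, ∀ m ∈ P.support, ∃ k : ℤ, ∀ i : Fin n,
          ((m (Fin.succ i) : ℕ) : ℤ) = a i + k * v i) →
      ¬ (∃ a v : Fin n → ℤ, ∀ m ∈ Q.support, ∃ k : ℤ, ∀ i : Fin n,
          ((m (Fin.succ i) : ℕ) : ℤ) = a i + k * v i) →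
      IsRelPrime P Q →
      Set.Finite {z : ℂ | MvPolynomial.aeval (Fin.cons z fun i => Complex.exp ((β i : ℂ) * z)) P = 0 ∧
        MvPolynomial.aeval (Fin.cons z fun i => Complex.exp ((β i : ℂ) * z)) Q = 0} := by
  sorry

/-! ## Glue: notation, the common-zero set, and the factorisation reduction (sorry-free) -/

section Glue

variable {n : ℕ}

/-- The evaluation point `(z, e^{β₁ z}, …, e^{βₙ z})`. -/
noncomputable def pt (β : Fin n → ↥(algebraicClosure ℚ ℂ)) (z : ℂ) : Fin (n + 1) → ℂ :=
  Fin.cons z fun i => Complex.exp ((β i : ℂ) * z)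

/-- The common-zero set of the pair `(P, Q)` along the curve `z ↦ pt β z`. -/
def Z (β : Fin n → ↥(algebraicClosure ℚ ℂ))
    (P Q : MvPolynomial (Fin (n + 1)) ↥(algebraicClosure ℚ ℂ)) : Set ℂ :=
  {z : ℂ | MvPolynomial.aeval (pt β z) P = 0 ∧ MvPolynomial.aeval (pt β z) Q = 0}

/-- Ritt-simplicity of `P` read off the support: the `X₁..Xₙ`-exponent vectors are affinely
collinear over `ℤ`. -/
def Collinear (P : MvPolynomial (Fin (n + 1)) ↥(algebraicClosure ℚ ℂ)) : Prop :=
  ∃ a v : Fin n → ℤ, ∀ m ∈ P.support, ∃ k : ℤ, ∀ i : Fin n,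
    ((m (Fin.succ i) : ℕ) : ℤ) = a i + k * v i

theorem Z_comm (β : Fin n → ↥(algebraicClosure ℚ ℂ))
    (P Q : MvPolynomial (Fin (n + 1)) ↥(algebraicClosure ℚ ℂ)) : Z β P Q = Z β Q P := by
  ext z
  simp only [Z, Set.mem_setOf_eq]
  exact and_comm

theorem Z_mul_left (β : Fin n → ↥(algebraicClosure ℚ ℂ))
    (P₁ P₂ Q : MvPolynomial (Fin (n + 1)) ↥(algebraicClosure ℚ ℂ)) :
    Z β (P₁ * P₂) Q = Z β P₁ Q ∪ Z β P₂ Q := by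
  ext z
  simp only [Z, Set.mem_setOf_eq, Set.mem_union, map_mul, mul_eq_zero]
  tauto

theorem Z_mul_right (β : Fin n → ↥(algebraicClosure ℚ ℂ))
    (P Q₁ Q₂ : MvPolynomial (Fin (n + 1)) ↥(algebraicClosure ℚ ℂ)) :
    Z β P (Q₁ * Q₂) = Z β P Q₁ ∪ Z β P Q₂ := by
  rw [Z_comm, Z_mul_left, Z_comm β Q₁, Z_comm β Q₂]

theorem Z_eq_empty_of_isUnit_left (β : Fin n → ↥(algebraicClosure ℚ ℂ))
    {P : MvPolynomial (Fin (n + 1)) ↥(algebraicClosure ℚ ℂ)} (hP : IsUnit P)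
    (Q : MvPolynomial (Fin (n + 1)) ↥(algebraicClosure ℚ ℂ)) : Z β P Q = ∅ := by
  ext z
  simp only [Z, Set.mem_setOf_eq, Set.mem_empty_iff_false, iff_false, not_and]
  intro h
  exact absurd h (hP.map (MvPolynomial.aeval (pt β z))).ne_zero

theorem Z_eq_empty_of_isUnit_right (β : Fin n → ↥(algebraicClosure ℚ ℂ))
    (P : MvPolynomial (Fin (n + 1)) ↥(algebraicClosure ℚ ℂ))
    {Q : MvPolynomial (Fin (n + 1)) ↥(algebraicClosure ℚ ℂ)} (hQ : IsUnit Q) : Z β P Q = ∅ := by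
  rw [Z_comm]
  exact Z_eq_empty_of_isUnit_left β hQ P

end Glue

/-! ## The three sector statements by name (verbatim the stub signatures) -/

/-- Sector A0 = the statement of `stub_simpleFactorConstCoeff`. -/
def SimpleFactorConstCoeff : Prop :=
  ∀ (n : ℕ) (β : Fin n → ↥(algebraicClosure ℚ ℂ))
    (P Q : MvPolynomial (Fin (n + 1)) ↥(algebraicClosure ℚ ℂ)),
    LinearIndependent ℚ β → Irreducible P →
    (∃ a v : Fin n → ℤ, ∀ m ∈ P.support, ∃ k : ℤ, ∀ i : Fin n,
        ((m (Fin.succ i) : ℕ) : ℤ) = a i + k * v i) →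
    (∀ m ∈ P.support, m 0 = 0) →
    IsRelPrime P Q →
    Set.Finite {z : ℂ | MvPolynomial.aeval (Fin.cons z fun i => Complex.exp ((β i : ℂ) * z)) P = 0 ∧
      MvPolynomial.aeval (Fin.cons z fun i => Complex.exp ((β i : ℂ) * z)) Q = 0}

/-- Sector A1 = the statement of `stub_simpleFactorPolyCoeff`. -/
def SimpleFactorPolyCoeff : Prop :=
  ∀ (n : ℕ) (β : Fin n → ↥(algebraicClosure ℚ ℂ))
    (P Q : MvPolynomial (Fin (n + 1)) ↥(algebraicClosure ℚ ℂ)),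
    LinearIndependent ℚ β → Irreducible P →
    (∃ a v : Fin n → ℤ, ∀ m ∈ P.support, ∃ k : ℤ, ∀ i : Fin n,
        ((m (Fin.succ i) : ℕ) : ℤ) = a i + k * v i) →
    (∃ m ∈ P.support, m 0 ≠ 0) →
    IsRelPrime P Q →
    Set.Finite {z : ℂ | MvPolynomial.aeval (Fin.cons z fun i => Complex.exp ((β i : ℂ) * z)) P = 0 ∧
      MvPolynomial.aeval (Fin.cons z fun i => Complex.exp ((β i : ℂ) * z)) Q = 0}

/-- Sector B = the statement of `stub_irreducibleNonSimplePair`. -/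
def IrreducibleNonSimplePair : Prop :=
  ∀ (n : ℕ) (β : Fin n → ↥(algebraicClosure ℚ ℂ))
    (P Q : MvPolynomial (Fin (n + 1)) ↥(algebraicClosure ℚ ℂ)),
    LinearIndependent ℚ β → Irreducible P → Irreducible Q →
    ¬ (∃ a v : Fin n → ℤ, ∀ m ∈ P.support, ∃ k : ℤ, ∀ i : Fin n,
        ((m (Fin.succ i) : ℕ) : ℤ) = a i + k * v i) →
    ¬ (∃ a v : Fin n → ℤ, ∀ m ∈ Q.support, ∃ k : ℤ, ∀ i : Fin n,
        ((m (Fin.succ i) : ℕ) : ℤ) = a i + k * v i) →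
    IsRelPrime P Q →
    Set.Finite {z : ℂ | MvPolynomial.aeval (Fin.cons z fun i => Complex.exp ((β i : ℂ) * z)) P = 0 ∧
      MvPolynomial.aeval (Fin.cons z fun i => Complex.exp ((β i : ℂ) * z)) Q = 0}

/-! ## The assembly -/

/-- SORRY-FREE GLUE: the three sectors imply Shapiro over ℚ̄ for every coprime pair, by unique
factorisation in `ℚ̄[X₀, …, Xₙ]` and dispatch of each pair of irreducible factors. -/
theorem finite_common_zeros_of_sectors (hA0 : SimpleFactorConstCoeff) (hA1 : SimpleFactorPolyCoeff)
    (hB : IrreducibleNonSimplePair) (n : ℕ) (β : Fin n → ↥(algebraicClosure ℚ ℂ))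
    (hβ : LinearIndependent ℚ β) :
    ∀ P Q : MvPolynomial (Fin (n + 1)) ↥(algebraicClosure ℚ ℂ), IsRelPrime P Q → (Z β P Q).Finite := by
  -- (1) an irreducible collinear (= simple) left factor against an arbitrary coprime `Q`
  have hA : ∀ p Q : MvPolynomial (Fin (n + 1)) ↥(algebraicClosure ℚ ℂ),
      Irreducible p → Collinear p → IsRelPrime p Q → (Z β p Q).Finite := by
    intro p Q hp hcol hpQ
    by_cases hc : ∀ m ∈ p.support, m 0 = 0
    · exact hA0 n β p Q hβ hp hcol hc hpQ
    · push Not at hc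
      exact hA1 n β p Q hβ hp hcol hc hpQ
  -- (2) an irreducible non-simple left factor: peel irreducible factors off `Q`
  have hQ : ∀ p : MvPolynomial (Fin (n + 1)) ↥(algebraicClosure ℚ ℂ), Irreducible p → ¬ Collinear p →
      ∀ Q : MvPolynomial (Fin (n + 1)) ↥(algebraicClosure ℚ ℂ), IsRelPrime p Q → (Z β p Q).Finite := by
    intro p hp hpc Q
    induction Q using WfDvdMonoid.induction_on_irreducible with
    | zero =>
      intro h
      exact absurd (isRelPrime_zero_right.1 h) hp.not_isUnit
    | unit u hu =>
      intro _
      rw [Z_eq_empty_of_isUnit_right β p hu]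
      exact Set.finite_empty
    | mul a q _ hq ih =>
      intro h
      rw [Z_mul_right]
      refine Set.Finite.union ?_ (ih h.of_mul_right_right)
      by_cases hqc : Collinear q
      · rw [Z_comm]
        exact hA q p hq hqc h.of_mul_right_left.symm
      · exact hB n β p q hβ hp hq hpc hqc h.of_mul_right_left
  -- (3) peel irreducible factors off `P`
  intro P
  induction P using WfDvdMonoid.induction_on_irreducible with
  | zero =>
    intro Q h
    rw [Z_eq_empty_of_isUnit_right β 0 (isRelPrime_zero_left.1 h)]
    exact Set.finite_empty
  | unit u hu =>
    intro Q _
    rw [Z_eq_empty_of_isUnit_left β hu]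
    exact Set.finite_empty
  | mul a p _ hp ih =>
    intro Q h
    rw [Z_mul_left]
    refine Set.Finite.union ?_ (ih Q h.of_mul_left_right)
    by_cases hpc : Collinear p
    · exact hA p Q hp hpc h.of_mul_left_left
    · exact hQ p hp hpc Q h.of_mul_left_left

/-- THE SKELETON THEOREM: the crux `CoprimeExpPolynomialsFiniteCommonZeros` BY NAME from the three
stubs (the only sorries of this file) through the sorry-free factorisation glue. -/
theorem CoprimeExpPolynomialsFiniteCommonZeros_of : CoprimeExpPolynomialsFiniteCommonZeros := by
  intro n β P Q hβ hPQ
  exact finite_common_zeros_of_sectors stub_simpleFactorConstCoeff stub_simpleFactorPolyCoeff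
    stub_irreducibleNonSimplePair n β hβ P Q hPQ

end Summit.Schanuel.Schanuel.Cruxes.CoprimeExpPolynomialsFiniteCommonZeros.Birth
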